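import Literature.NumberTheory.Sieve.Maynard2016Lemma7CubeEstimate
import Literature.NumberTheory.Sieve.Maynard2016Lemma7MainLower
import Literature.NumberTheory.Sieve.Maynard2016CoupledBoxWPolylog
import Literature.NumberTheory.Sieve.Maynard2016Lemma6PairBound

/-!
# Maynard (2016), Lemma 7: one pair of cutoffs on the free slots — proof of `Lemma7PairBound`

J. Maynard, *Large gaps between primes*, Ann. of Math. (2) 183 (2016), 915–933 = arXiv:1408.5110,
§6, proof of Lemma 7 (the analogue of displays (6.8)–(6.19) for the `φ`-weighted coupled sums of
the solvable tuples, displays (6.29)–(6.33)).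

The port of `Maynard2016Lemma6PairBound` to the `(k−1)`-slot engine of `Maynard2016CoupledBoxW`:
index types `ι = κ = {ℓ // ℓ ≠ i}`, weight `phiInv = 1/φ`, coupling
`restrictPairs i i (couplingSet7 p₀ i)`, singular series `𝔖⁷ = singSmall (k−1) x · nuProd7`.
* `integral_coupledPhi_mul_pairModel7` — `∫ Φ(p) M(p.1) M(p.2) = pairConst7` ((6.19)), any `ι, κ`;
* `eventually_pair7_pointwise` — the pointwise bound from the cube estimate
  (`eventually_norm_kernelW7_sub_model_le`), the crude bound `eventually_norm_logpow_mul_kernelW_le`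
  and rapid decay off the cube;
* `eventually_pair7_pointwise'`, `eventually_norm_logpow_mul_coupledLcmSumW7_sub_le_of_psiMaj_le` —
  the same two statements UNIFORMLY over all cutoff families whose one-slot majorants `ψ_l` are
  dominated by those of a fixed reference family (the `x`-threshold depends on the cutoffs only
  through the majorant integrals; used for the `x`-dependent shifted cutoffs `F(· + log p/log x)` of
  the congruence-class correction `Lemma7ClassMoment`);
* **`lemma7PairBound_holds : Lemma7PairBound`**, whence
  **`lemma7MainLower_holds : Lemma7MainLower`** (`lemma7MainLower_of_pairBound`): the main-term
  named fact of `Maynard2016Lemma7Assembly` is PROVED; with it, Maynard's Theorem 1 depends on the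
  single remaining named fact `Lemma7ClassMoment` (`lemma7Tuple_of_parts`, `theorem1_of_lemma7Tuple`).

## References

* J. Maynard, *Large gaps between primes*, Ann. of Math. (2) 183 (2016), 915–933; arXiv:1408.5110,
  §6, proof of Lemma 7; displays (6.8)–(6.19), (6.29)–(6.33). [Maynard2016LargeGaps]
* D. H. J. Polymath, *Variants of the Selberg sieve, and bounded intervals containing many primes*,
  Res. Math. Sci. 1 (2014), Art. 12; arXiv:1407.4897, proof of Lemma 4.1, p. 13. [Polymath8b2014]
-/

noncomputable section

open Filter Finset Real MeasureTheory
open scoped BigOperators Topology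

namespace Literature.NumberTheory.Sieve

namespace Maynard2016

open LcmEuler

/-! ### (6.19) and the majorants, on general index types -/

section Generic

variable {ι κ : Type*} [Fintype ι] [DecidableEq ι] [Fintype κ] [DecidableEq κ]
  {F F' : ι → ℝ → ℝ} {G G' : κ → ℝ → ℝ} {sF sF' : ι → ℝ} {sG sG' : κ → ℝ}
  (hF : ∀ i, IsSieveCutoff (F i) (sF i)) (hF' : ∀ i, IsSieveCutoff (F' i) (sF' i))
  (hG : ∀ j, IsSieveCutoff (G j) (sG j)) (hG' : ∀ j, IsSieveCutoff (G' j) (sG' j))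

omit [DecidableEq ι] [DecidableEq κ] in
include hF hF' hG hG' in
/-- **(6.19)** on general index types: `∫ Φ(p) M(p.1) M(p.2) dp = pairConst7 F F' G G'`.
[cite: Maynard2016LargeGaps, §6 display (6.19)] -/
theorem integral_coupledPhi_mul_pairModel7 :
    ∫ p : (ι → ℝ × ℝ) × (κ → ℝ × ℝ), coupledPhi hF hF' hG hG' p * (pairModel p.1 * pairModel p.2) =
      pairConst7 F F' G G' := by
  have h : ∀ p : (ι → ℝ × ℝ) × (κ → ℝ × ℝ),
      coupledPhi hF hF' hG hG' p * (pairModel p.1 * pairModel p.2) =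
        (fourierPhi hF hF' p.1 * pairModel p.1) * (fourierPhi hG hG' p.2 * pairModel p.2) := by
    intro p; unfold coupledPhi; ring
  simp_rw [h]
  rw [MeasureTheory.Measure.volume_eq_prod, integral_prod_mul
    (f := fun p₁ : ι → ℝ × ℝ => fourierPhi hF hF' p₁ * pairModel p₁)
    (g := fun p₂ : κ → ℝ × ℝ => fourierPhi hG hG' p₂ * pairModel p₂),
    integral_fourierPhi_mul_pairModel hF hF', integral_fourierPhi_mul_pairModel hG hG']
  rfl

omit [DecidableEq ι] [DecidableEq κ] in
/-- `‖Φ(p)‖ ≤ Ψ₁(p.1) Ψ₂(p.2)`. [folklore] -/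
private theorem norm_coupledPhi_le7 (p : (ι → ℝ × ℝ) × (κ → ℝ × ℝ)) :
    ‖coupledPhi hF hF' hG hG' p‖ ≤ PsiMaj hF hF' p.1 * PsiMaj hG hG' p.2 := by
  unfold coupledPhi
  rw [norm_mul]
  exact mul_le_mul (norm_fourierPhi_le hF hF' p.1) (norm_fourierPhi_le hG hG' p.2) (norm_nonneg _)
    (PsiMaj_nonneg hF hF' p.1)

omit [DecidableEq ι] [DecidableEq κ] in
/-- `‖Φ(p)‖ ‖M(p.1) M(p.2)‖ ≤ Ψ₁(p.1) Ψ₂(p.2)`. [folklore] -/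
private theorem norm_coupledPhi_mul_pairModel_le7 (p : (ι → ℝ × ℝ) × (κ → ℝ × ℝ)) :
    ‖coupledPhi hF hF' hG hG' p‖ * ‖pairModel p.1 * pairModel p.2‖ ≤
      PsiMaj hF hF' p.1 * PsiMaj hG hG' p.2 := by
  unfold coupledPhi
  rw [norm_mul, norm_mul, show ‖fourierPhi hF hF' p.1‖ * ‖fourierPhi hG hG' p.2‖ *
      (‖pairModel p.1‖ * ‖pairModel p.2‖) = (‖fourierPhi hF hF' p.1‖ * ‖pairModel p.1‖) *
        (‖fourierPhi hG hG' p.2‖ * ‖pairModel p.2‖) by ring]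
  exact mul_le_mul (norm_fourierPhi_mul_pairModel_le hF hF' p.1)
    (norm_fourierPhi_mul_pairModel_le hG hG' p.2) (by positivity) (PsiMaj_nonneg hF hF' p.1)

/-- The combined majorant `a Ψ₁Ψ₂ + b (Ψ^B₁ Ψ₂ + Ψ₁ Ψ^B₂)` on general index types. [folklore] -/
def pairMaj7 (n : ℕ) (a b : ℝ) (p : (ι → ℝ × ℝ) × (κ → ℝ × ℝ)) : ℝ :=
  a * (PsiMaj hF hF' p.1 * PsiMaj hG hG' p.2) +
    b * (PsiMajB hF hF' n p.1 * PsiMaj hG hG' p.2 + PsiMaj hF hF' p.1 * PsiMajB hG hG' n p.2)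

/-- The combined majorant is integrable, with integral `a I₁ I₂ + b (I^B₁ I₂ + I₁ I^B₂)`. [folklore] -/
private theorem integral_pairMaj7 (n : ℕ) (a b : ℝ) :
    Integrable (pairMaj7 hF hF' hG hG' n a b) ∧
      ∫ p, pairMaj7 hF hF' hG hG' n a b p =
        a * ((∫ p₁, PsiMaj hF hF' p₁) * ∫ p₂, PsiMaj hG hG' p₂) +
          b * ((∫ p₁, PsiMajB hF hF' n p₁) * (∫ p₂, PsiMaj hG hG' p₂) +
            (∫ p₁, PsiMaj hF hF' p₁) * ∫ p₂, PsiMajB hG hG' n p₂) := by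
  have h1 : Integrable (fun p : (ι → ℝ × ℝ) × (κ → ℝ × ℝ) =>
      PsiMaj hF hF' p.1 * PsiMaj hG hG' p.2) :=
    (integrable_PsiMaj hF hF').mul_prod (integrable_PsiMaj hG hG')
  have h2 : Integrable (fun p : (ι → ℝ × ℝ) × (κ → ℝ × ℝ) =>
      PsiMajB hF hF' n p.1 * PsiMaj hG hG' p.2) :=
    (integrable_PsiMajB hF hF' n).mul_prod (integrable_PsiMaj hG hG')
  have h3 : Integrable (fun p : (ι → ℝ × ℝ) × (κ → ℝ × ℝ) =>
      PsiMaj hF hF' p.1 * PsiMajB hG hG' n p.2) :=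
    (integrable_PsiMaj hF hF').mul_prod (integrable_PsiMajB hG hG' n)
  have h23 : Integrable (fun p : (ι → ℝ × ℝ) × (κ → ℝ × ℝ) =>
      PsiMajB hF hF' n p.1 * PsiMaj hG hG' p.2 + PsiMaj hF hF' p.1 * PsiMajB hG hG' n p.2) :=
    h2.add h3
  have hI : Integrable (pairMaj7 hF hF' hG hG' n a b) := by
    have h := (h1.const_mul a).add (h23.const_mul b)
    refine h.congr (ae_of_all _ fun p => ?_)
    simp only [pairMaj7, Pi.add_apply]
  refine ⟨hI, ?_⟩
  have hsplit : ∫ p, pairMaj7 hF hF' hG hG' n a b p =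
      (∫ p : (ι → ℝ × ℝ) × (κ → ℝ × ℝ), a * (PsiMaj hF hF' p.1 * PsiMaj hG hG' p.2)) +
        ∫ p : (ι → ℝ × ℝ) × (κ → ℝ × ℝ),
          b * (PsiMajB hF hF' n p.1 * PsiMaj hG hG' p.2 + PsiMaj hF hF' p.1 * PsiMajB hG hG' n p.2) := by
    rw [← integral_add (h1.const_mul a) (h23.const_mul b)]
    rfl
  rw [hsplit, integral_const_mul, integral_const_mul, integral_add h2 h3,
    MeasureTheory.Measure.volume_eq_prod,
    integral_prod_mul (f := PsiMaj hF hF') (g := PsiMaj hG hG'),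
    integral_prod_mul (f := PsiMajB hF hF' n) (g := PsiMaj hG hG'),
    integral_prod_mul (f := PsiMaj hF hF') (g := PsiMajB hG hG' n)]

end Generic

/-! ### The pointwise bound and the pair estimate on the free slots `ℓ ≠ i` -/

section Pair

variable {k : ℕ} {i : Fin k} {F F' G G' : {l : Fin k // l ≠ i} → ℝ → ℝ}
  {sF sF' sG sG' : {l : Fin k // l ≠ i} → ℝ}
  (hF : ∀ l, IsSieveCutoff (F l) (sF l)) (hF' : ∀ l, IsSieveCutoff (F' l) (sF' l))
  (hG : ∀ l, IsSieveCutoff (G l) (sG l)) (hG' : ∀ l, IsSieveCutoff (G' l) (sG' l))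

/-- The exponent `T⁷ = 2·crudeExp (k−1) (k−1) + 2(k−1)`
(`‖(log x)^{k−1} (log y)^{k−1} K‖ ≤ 2^{2 crudeExp} (√log x)^{2T⁷}`). [folklore] -/
def tailExp7 (k : ℕ) : ℕ := 2 * crudeExp (k - 1) (k - 1) + 2 * (k - 1)

/-- **The pointwise bound, uniformly in the cutoffs** (on the cube by `eventually_norm_kernelW7_sub_model_le`, off it by the crude
bound and rapid decay): eventually in `x`, for all `1 ≤ m ≤ x < p₀ ≤ x²` and ALL frequencies `p`,
`‖Φ(p) ((log x)^{k−1} (log y)^{k−1} K(p) − 𝔖⁷ M(p.1)M(p.2))‖ ≤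
   η 𝔖⁷ Ψ₁Ψ₂ + (2^{2 crudeExp} + 𝔖⁷)/(1 + √log x) · (Ψ^B₁ Ψ₂ + Ψ₁ Ψ^B₂)` with `B = 2·tailExp7 k + 1`.
The `x`-threshold does not depend on the cutoffs (they enter only through `Φ` and the majorants).
[cite: Maynard2016LargeGaps, Lemma 7 (proof, displays (6.16)–(6.18))] -/
theorem eventually_pair7_pointwise' (k : ℕ) (i : Fin k) {ε : ℝ} (hε0 : 0 < ε) (hε : ε ≤ 1 / 2)
    {η : ℝ} (hη : 0 < η) :
    ∀ᶠ x : ℕ in atTop, ∀ {F F' G G' : {l : Fin k // l ≠ i} → ℝ → ℝ}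
      {sF sF' sG sG' : {l : Fin k // l ≠ i} → ℝ}
      (hF : ∀ l, IsSieveCutoff (F l) (sF l)) (hF' : ∀ l, IsSieveCutoff (F' l) (sF' l))
      (hG : ∀ l, IsSieveCutoff (G l) (sG l)) (hG' : ∀ l, IsSieveCutoff (G' l) (sG' l)),
      ∀ m p₀ : ℕ, 1 ≤ m → m ≤ x → x < p₀ → (p₀ : ℝ) ≤ (x : ℝ) ^ 2 →
      ∀ p : ({l : Fin k // l ≠ i} → ℝ × ℝ) × ({l : Fin k // l ≠ i} → ℝ × ℝ),
        ‖coupledPhi hF hF' hG hG' p *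
            ((Real.log x : ℂ) ^ (k - 1) * (Real.log (y ε x) : ℂ) ^ (k - 1) *
                coupledFreqKernelW phiInv (Pw x) m (restrictPairs i i (couplingSet7 k x m p₀ i))
                  (x : ℝ) (y ε x) p -
              ((singSmall (k - 1) x * nuProd7 k x m p₀ i : ℝ) : ℂ) * (pairModel p.1 * pairModel p.2))‖ ≤
          pairMaj7 hF hF' hG hG' (2 * tailExp7 k + 1) (η * (singSmall (k - 1) x * nuProd7 k x m p₀ i))
            (((2 : ℝ) ^ (2 * crudeExp (k - 1) (k - 1)) + singSmall (k - 1) x * nuProd7 k x m p₀ i) /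
              (1 + Real.sqrt (Real.log x))) p := by
  have hcard : Fintype.card {l : Fin k // l ≠ i} = k - 1 := card_slots_ne_eq k i
  filter_upwards [eventually_norm_kernelW7_sub_model_le hε0 hε k i hη,
    eventually_norm_logpow_mul_kernelW_le (ι := {l : Fin k // l ≠ i}) (κ := {l : Fin k // l ≠ i})
      isLcmWeight_phiInv,
    eventually_iteratedLogs, eventually_y_lt_half hε0 (by linarith), eventually_gt_atTop 1]
    with x hcube hcrude hlogs hyx hx1
  obtain ⟨hL, hL2, hL3, -, hL2L, -, -⟩ := hlogs
  intro F F' G G' sF sF' sG sG' hF hF' hG hG' m p₀ hm1 hm hxp hp2 p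
  have hcube' := hcube m p₀ hm1 hm hxp hp2
  have hε1 : ε < 1 := by linarith
  have hL0 : 0 < Real.log x := by linarith
  have hly : 0 < Real.log (y ε x) := log_y_pos hε (by linarith) (by linarith) hL3
  have hy1 : 1 < y ε x := by
    by_contra h
    exact absurd (Real.log_nonpos (Real.exp_pos _).le (not_lt.1 h)) (not_le.2 hly)
  have hyx' : y ε x ≤ x := by linarith
  set S₀ : ℝ := singSmall (k - 1) x * nuProd7 k x m p₀ i with hS₀
  have hS0 : 0 < S₀ := mul_pos (singSmall_pos (k - 1) x) (nuProd7_pos k x m p₀ i)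
  set R : ℝ := Real.sqrt (Real.log x) with hRdef
  have hR0 : 0 ≤ R := Real.sqrt_nonneg _
  have hR1 : 0 < 1 + R := by linarith
  set Cr : ℝ := (2 : ℝ) ^ (2 * crudeExp (k - 1) (k - 1)) with hCr
  set X : ℂ := (Real.log x : ℂ) ^ (k - 1) * (Real.log (y ε x) : ℂ) ^ (k - 1) *
    coupledFreqKernelW phiInv (Pw x) m (restrictPairs i i (couplingSet7 k x m p₀ i))
      (x : ℝ) (y ε x) p with hX
  set MM : ℂ := pairModel p.1 * pairModel p.2 with hMM
  have hΨ₁ := PsiMaj_nonneg hF hF' p.1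
  have hΨ₂ := PsiMaj_nonneg hG hG' p.2
  have hΨB₁ := PsiMajB_nonneg hF hF' (2 * tailExp7 k + 1) p.1
  have hΨB₂ := PsiMajB_nonneg hG hG' (2 * tailExp7 k + 1) p.2
  have hΦ := norm_coupledPhi_le7 hF hF' hG hG' p
  have hΦM := norm_coupledPhi_mul_pairModel_le7 hF hF' hG hG' p
  have hsecond : 0 ≤ (Cr + S₀) / (1 + R) *
      (PsiMajB hF hF' (2 * tailExp7 k + 1) p.1 * PsiMaj hG hG' p.2 +
        PsiMaj hF hF' p.1 * PsiMajB hG hG' (2 * tailExp7 k + 1) p.2) := by positivity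
  unfold pairMaj7
  by_cases hc : InCube R p.1 ∧ InCube R p.2
  · -- on the cube
    have h1 := hcube' p hc.1 hc.2
    rw [norm_mul]
    calc ‖coupledPhi hF hF' hG hG' p‖ * ‖X - (S₀ : ℂ) * MM‖
        ≤ ‖coupledPhi hF hF' hG hG' p‖ * (η * S₀ * ‖MM‖) := mul_le_mul_of_nonneg_left h1 (norm_nonneg _)
      _ = η * S₀ * (‖coupledPhi hF hF' hG hG' p‖ * ‖MM‖) := by ring
      _ ≤ η * S₀ * (PsiMaj hF hF' p.1 * PsiMaj hG hG' p.2) :=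
          mul_le_mul_of_nonneg_left hΦM (by positivity)
      _ ≤ _ := le_add_of_nonneg_right hsecond
  · -- off the cube
    have hXle : ‖X‖ ≤ Cr * R ^ (2 * tailExp7 k) := by
      have h := hcrude m (restrictPairs i i (couplingSet7 k x m p₀ i)) (y ε x) hy1 hyx' p
      rw [hcard] at h
      refine h.trans (le_of_eq ?_)
      have hR2 : R ^ 2 = Real.log x := by rw [hRdef, Real.sq_sqrt hL0.le]
      rw [show R ^ (2 * tailExp7 k) = Real.log x ^ tailExp7 k by rw [pow_mul, hR2], tailExp7, hCr,
        mul_pow]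
      ring
    have hstep : ‖X - (S₀ : ℂ) * MM‖ ≤ Cr * R ^ (2 * tailExp7 k) + S₀ * ‖MM‖ := by
      refine (norm_sub_le _ _).trans (add_le_add hXle (le_of_eq ?_))
      rw [norm_mul, Complex.norm_real, Real.norm_eq_abs, abs_of_pos hS0]
    set n : ℕ := 2 * tailExp7 k + 1 with hn
    have hn1 : 1 ≤ n := by omega
    have hCr0 : 0 ≤ Cr := by positivity
    have key : ∀ {Ψo ΨBo Ψg : ℝ} {po : {l : Fin k // l ≠ i} → ℝ × ℝ}, ¬ InCube R po → 0 ≤ Ψo →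
        0 ≤ Ψg → ΨBo = Ψo * ∑ l, ((1 + |(po l).1|) ^ n + (1 + |(po l).2|) ^ n) →
        ‖coupledPhi hF hF' hG hG' p‖ ≤ Ψo * Ψg →
        ‖coupledPhi hF hF' hG hG' p‖ * ‖MM‖ ≤ Ψo * Ψg →
        ‖coupledPhi hF hF' hG hG' p‖ * ‖X - (S₀ : ℂ) * MM‖ ≤ (Cr + S₀) / (1 + R) * (ΨBo * Ψg) := by
      intro Ψo ΨBo Ψg po hpo hΨo hΨg hBo hΦ' hΦM'
      obtain ⟨hb1, hb2⟩ := offCube_bounds (ι := {l : Fin k // l ≠ i}) hR0 hn1 hpo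
      have hnm : n - 1 = 2 * tailExp7 k := by omega
      rw [hnm] at hb1
      set T : ℝ := ∑ l, ((1 + |(po l).1|) ^ n + (1 + |(po l).2|) ^ n) with hT
      have hq1 : R ^ (2 * tailExp7 k) ≤ T / (1 + R) := by rw [le_div_iff₀ hR1]; linarith
      have hq2 : 1 ≤ T / (1 + R) := by rw [le_div_iff₀ hR1]; linarith
      calc ‖coupledPhi hF hF' hG hG' p‖ * ‖X - (S₀ : ℂ) * MM‖
          ≤ ‖coupledPhi hF hF' hG hG' p‖ * (Cr * R ^ (2 * tailExp7 k) + S₀ * ‖MM‖) :=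
            mul_le_mul_of_nonneg_left hstep (norm_nonneg _)
        _ = Cr * (‖coupledPhi hF hF' hG hG' p‖ * R ^ (2 * tailExp7 k)) +
              S₀ * (‖coupledPhi hF hF' hG hG' p‖ * ‖MM‖) := by ring
        _ ≤ Cr * (Ψo * Ψg * (T / (1 + R))) + S₀ * (Ψo * Ψg * (T / (1 + R))) := by
            have e1 : ‖coupledPhi hF hF' hG hG' p‖ * R ^ (2 * tailExp7 k) ≤ Ψo * Ψg * (T / (1 + R)) :=
              mul_le_mul hΦ' hq1 (by positivity) (by positivity)
            have e2 : ‖coupledPhi hF hF' hG hG' p‖ * ‖MM‖ ≤ Ψo * Ψg * (T / (1 + R)) := by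
              have := mul_le_mul hΦM' hq2 zero_le_one (by positivity)
              rwa [mul_one] at this
            exact add_le_add (mul_le_mul_of_nonneg_left e1 hCr0)
              (mul_le_mul_of_nonneg_left e2 hS0.le)
        _ = (Cr + S₀) / (1 + R) * (ΨBo * Ψg) := by
            rw [hBo, div_eq_mul_inv, div_eq_mul_inv]; ring
    rw [norm_mul]
    refine le_trans ?_ (le_add_of_nonneg_left (by positivity))
    rcases not_and_or.1 hc with hc1 | hc2
    · have h := key hc1 hΨ₁ hΨ₂ (PsiMajB_eq hF hF' n p.1) hΦ hΦM
      refine h.trans ?_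
      have : 0 ≤ (Cr + S₀) / (1 + R) * (PsiMaj hF hF' p.1 * PsiMajB hG hG' n p.2) := by
        positivity
      rw [mul_add]; linarith
    · have hΦ' : ‖coupledPhi hF hF' hG hG' p‖ ≤ PsiMaj hG hG' p.2 * PsiMaj hF hF' p.1 := by
        rw [mul_comm]; exact hΦ
      have hΦM' : ‖coupledPhi hF hF' hG hG' p‖ * ‖MM‖ ≤ PsiMaj hG hG' p.2 * PsiMaj hF hF' p.1 := by
        rw [mul_comm (PsiMaj hG hG' p.2)]; exact hΦM
      have h := key hc2 hΨ₂ hΨ₁ (PsiMajB_eq hG hG' n p.2) hΦ' hΦM'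
      refine h.trans ?_
      have : 0 ≤ (Cr + S₀) / (1 + R) * (PsiMajB hF hF' n p.1 * PsiMaj hG hG' p.2) := by
        positivity
      rw [mul_comm (PsiMajB hG hG' n p.2)] at h
      rw [mul_add]; linarith

include hF hF' hG hG' in
/-- **The pointwise bound** for one family of cutoffs (`eventually_pair7_pointwise'`).
[cite: Maynard2016LargeGaps, Lemma 7 (proof, displays (6.16)–(6.18))] -/
theorem eventually_pair7_pointwise {ε : ℝ} (hε0 : 0 < ε) (hε : ε ≤ 1 / 2) {η : ℝ} (hη : 0 < η) :
    ∀ᶠ x : ℕ in atTop, ∀ m p₀ : ℕ, 1 ≤ m → m ≤ x → x < p₀ → (p₀ : ℝ) ≤ (x : ℝ) ^ 2 →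
      ∀ p : ({l : Fin k // l ≠ i} → ℝ × ℝ) × ({l : Fin k // l ≠ i} → ℝ × ℝ),
        ‖coupledPhi hF hF' hG hG' p *
            ((Real.log x : ℂ) ^ (k - 1) * (Real.log (y ε x) : ℂ) ^ (k - 1) *
                coupledFreqKernelW phiInv (Pw x) m (restrictPairs i i (couplingSet7 k x m p₀ i))
                  (x : ℝ) (y ε x) p -
              ((singSmall (k - 1) x * nuProd7 k x m p₀ i : ℝ) : ℂ) * (pairModel p.1 * pairModel p.2))‖ ≤
          pairMaj7 hF hF' hG hG' (2 * tailExp7 k + 1) (η * (singSmall (k - 1) x * nuProd7 k x m p₀ i))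
            (((2 : ℝ) ^ (2 * crudeExp (k - 1) (k - 1)) + singSmall (k - 1) x * nuProd7 k x m p₀ i) /
              (1 + Real.sqrt (Real.log x))) p := by
  filter_upwards [eventually_pair7_pointwise' k i hε0 hε hη] with x hx m p₀ hm1 hm hxp hp2 p
  exact hx hF hF' hG hG' m p₀ hm1 hm hxp hp2 p

set_option maxHeartbeats 800000 in
include hF hF' hG hG' in
/-- **One pair of cutoffs on the free slots, uniformly in `m, p₀` AND in all cutoff families
dominated by a reference family** ((6.29)–(6.33) via (6.8)–(6.19)): fix reference cutoffs
`F, F', G, G'`; for `0 < ε ≤ 1/2` and `η > 0`, eventually in `x : ℕ`, for every family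
`F₂, F₂', G₂, G₂'` of cutoffs supported in `[0,1]` whose one-slot majorants satisfy
`ψ_l[F₂,F₂'] ≤ ψ_l[F,F']` and `ψ_l[G₂,G₂'] ≤ ψ_l[G,G']` pointwise, and all `1 ≤ m ≤ x < p₀ ≤ x²`,
`‖(log x)^{k−1} (log y)^{k−1} S^φ[F₂,F₂',G₂,G₂'] − 𝔖⁷ c[F₂,F₂',G₂,G₂']‖ ≤ η 𝔖⁷`.
[cite: Maynard2016LargeGaps, Lemma 7 (proof, displays (6.29)–(6.33))] -/
theorem eventually_norm_logpow_mul_coupledLcmSumW7_sub_le_of_psiMaj_le {ε : ℝ} (hε0 : 0 < ε)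
    (hε : ε ≤ 1 / 2) {η : ℝ} (hη : 0 < η) :
    ∀ᶠ x : ℕ in atTop, ∀ {F₂ F₂' G₂ G₂' : {l : Fin k // l ≠ i} → ℝ → ℝ}
      {sF₂ sF₂' sG₂ sG₂' : {l : Fin k // l ≠ i} → ℝ}
      (hF₂ : ∀ l, IsSieveCutoff (F₂ l) (sF₂ l)) (hF₂' : ∀ l, IsSieveCutoff (F₂' l) (sF₂' l))
      (hG₂ : ∀ l, IsSieveCutoff (G₂ l) (sG₂ l)) (hG₂' : ∀ l, IsSieveCutoff (G₂' l) (sG₂' l)),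
      (∀ l, sF₂ l ≤ 1 ∧ sF₂' l ≤ 1) → (∀ l, sG₂ l ≤ 1 ∧ sG₂' l ≤ 1) →
      (∀ l q, psiMaj hF₂ hF₂' l q ≤ psiMaj hF hF' l q) →
      (∀ l q, psiMaj hG₂ hG₂' l q ≤ psiMaj hG hG' l q) →
      ∀ m p₀ : ℕ, 1 ≤ m → m ≤ x → x < p₀ → (p₀ : ℝ) ≤ (x : ℝ) ^ 2 →
      ‖(Real.log x : ℂ) ^ (k - 1) * (Real.log (y ε x) : ℂ) ^ (k - 1) *
            coupledLcmSumW phiInv (Pw x) m (restrictPairs i i (couplingSet7 k x m p₀ i))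
              F₂ F₂' G₂ G₂' (x : ℝ) (y ε x) x -
          ((singSmall (k - 1) x * nuProd7 k x m p₀ i : ℝ) : ℂ) * pairConst7 F₂ F₂' G₂ G₂'‖ ≤
        η * (singSmall (k - 1) x * nuProd7 k x m p₀ i) := by
  -- the constants
  set n : ℕ := 2 * tailExp7 k + 1 with hn
  set Cr : ℝ := (2 : ℝ) ^ (2 * crudeExp (k - 1) (k - 1)) with hCr
  have hCr0 : 0 ≤ Cr := by positivity
  set I₁ : ℝ := ∫ p₁, PsiMaj hF hF' p₁ with hI₁
  set I₂ : ℝ := ∫ p₂, PsiMaj hG hG' p₂ with hI₂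
  set IB₁ : ℝ := ∫ p₁, PsiMajB hF hF' n p₁ with hIB₁
  set IB₂ : ℝ := ∫ p₂, PsiMajB hG hG' n p₂ with hIB₂
  have hI₁0 : 0 ≤ I₁ := integral_nonneg (PsiMaj_nonneg hF hF')
  have hI₂0 : 0 ≤ I₂ := integral_nonneg (PsiMaj_nonneg hG hG')
  have hIB₁0 : 0 ≤ IB₁ := integral_nonneg (PsiMajB_nonneg hF hF' n)
  have hIB₂0 : 0 ≤ IB₂ := integral_nonneg (PsiMajB_nonneg hG hG' n)
  set J : ℝ := IB₁ * I₂ + I₁ * IB₂ with hJ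
  have hJ0 : 0 ≤ J := by positivity
  -- accuracy on the cube and the decay rate
  set η₁ : ℝ := η / (2 * (I₁ * I₂ + 1)) with hη₁
  have hη₁0 : 0 < η₁ := by positivity
  have hdec : Tendsto (fun x : ℕ => (2 * Cr + 1) * J / (1 + Real.sqrt (Real.log x)))
      atTop (𝓝 0) := by
    have h1 : Tendsto (fun x : ℕ => 1 + Real.sqrt (Real.log (x : ℝ))) atTop atTop :=
      tendsto_atTop_add_const_left _ 1 (Real.tendsto_sqrt_atTop.comp
        (Real.tendsto_log_atTop.comp tendsto_natCast_atTop_atTop))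
    simpa [div_eq_mul_inv] using (tendsto_inv_atTop_zero.comp h1).const_mul ((2 * Cr + 1) * J)
  filter_upwards [eventually_pair7_pointwise' k i hε0 hε hη₁0,
    hdec.eventually_le_const (half_pos hη), eventually_iteratedLogs,
    eventually_y_lt_half hε0 (by linarith), eventually_gt_atTop 1]
    with x hpt hdecx hlogs hyx hx1
  obtain ⟨hL, hL2, hL3, -, hL2L, -, -⟩ := hlogs
  intro F₂ F₂' G₂ G₂' sF₂ sF₂' sG₂ sG₂' hF₂ hF₂' hG₂ hG₂' hTF hTG hdomF hdomG m p₀ hm1 hm hxp hp2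
  -- the majorants of the dominated family are dominated
  have hΨF : ∀ q, PsiMaj hF₂ hF₂' q ≤ PsiMaj hF hF' q := fun q =>
    Finset.prod_le_prod (fun l _ => psiMaj_nonneg hF₂ hF₂' l (q l)) fun l _ => hdomF l (q l)
  have hΨG : ∀ q, PsiMaj hG₂ hG₂' q ≤ PsiMaj hG hG' q := fun q =>
    Finset.prod_le_prod (fun l _ => psiMaj_nonneg hG₂ hG₂' l (q l)) fun l _ => hdomG l (q l)
  have hΨBF : ∀ q, PsiMajB hF₂ hF₂' n q ≤ PsiMajB hF hF' n q := fun q => by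
    rw [PsiMajB_eq, PsiMajB_eq]
    exact mul_le_mul_of_nonneg_right (hΨF q) (Finset.sum_nonneg fun l _ => by positivity)
  have hΨBG : ∀ q, PsiMajB hG₂ hG₂' n q ≤ PsiMajB hG hG' n q := fun q => by
    rw [PsiMajB_eq, PsiMajB_eq]
    exact mul_le_mul_of_nonneg_right (hΨG q) (Finset.sum_nonneg fun l _ => by positivity)
  have hI₁le : ∫ p₁, PsiMaj hF₂ hF₂' p₁ ≤ I₁ :=
    integral_mono (integrable_PsiMaj hF₂ hF₂') (integrable_PsiMaj hF hF') hΨF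
  have hI₂le : ∫ p₂, PsiMaj hG₂ hG₂' p₂ ≤ I₂ :=
    integral_mono (integrable_PsiMaj hG₂ hG₂') (integrable_PsiMaj hG hG') hΨG
  have hIB₁le : ∫ p₁, PsiMajB hF₂ hF₂' n p₁ ≤ IB₁ :=
    integral_mono (integrable_PsiMajB hF₂ hF₂' n) (integrable_PsiMajB hF hF' n) hΨBF
  have hIB₂le : ∫ p₂, PsiMajB hG₂ hG₂' n p₂ ≤ IB₂ :=
    integral_mono (integrable_PsiMajB hG₂ hG₂' n) (integrable_PsiMajB hG hG' n) hΨBG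
  have hI₁0' : 0 ≤ ∫ p₁, PsiMaj hF₂ hF₂' p₁ := integral_nonneg (PsiMaj_nonneg hF₂ hF₂')
  have hI₂0' : 0 ≤ ∫ p₂, PsiMaj hG₂ hG₂' p₂ := integral_nonneg (PsiMaj_nonneg hG₂ hG₂')
  have hIB₁0' : 0 ≤ ∫ p₁, PsiMajB hF₂ hF₂' n p₁ := integral_nonneg (PsiMajB_nonneg hF₂ hF₂' n)
  have hIB₂0' : 0 ≤ ∫ p₂, PsiMajB hG₂ hG₂' n p₂ := integral_nonneg (PsiMajB_nonneg hG₂ hG₂' n)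
  have hL0 : 0 < Real.log x := by linarith
  have hly : 0 < Real.log (y ε x) := log_y_pos hε (by linarith) (by linarith) hL3
  have hy1 : 1 < y ε x := by
    by_contra h
    exact absurd (Real.log_nonpos (Real.exp_pos _).le (not_lt.1 h)) (not_le.2 hly)
  have hyx' : y ε x ≤ x := by linarith
  have hx0 : (0 : ℝ) ≤ x := by positivity
  set S₀ : ℝ := singSmall (k - 1) x * nuProd7 k x m p₀ i with hS₀
  have hS01 : 1 ≤ S₀ := by
    rw [hS₀]
    calc (1 : ℝ) = 1 * 1 := by ring
      _ ≤ singSmall (k - 1) x * nuProd7 k x m p₀ i :=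
          mul_le_mul (one_le_singSmall7 (k - 1) x) (one_le_nuProd7 k x m p₀ i) zero_le_one
            (by linarith [one_le_singSmall7 (k - 1) x])
  have hS0pos : 0 < S₀ := by linarith
  set M := restrictPairs i i (couplingSet7 k x m p₀ i) with hM
  -- `S = ∫ Φ K` with `D = x`
  have hD : supportBox (x : ℝ) (y ε x) 1 1 ≤ x := by
    unfold supportBox
    rw [Real.rpow_one, Real.rpow_one, Nat.floor_natCast]
    exact max_le le_rfl ((Nat.floor_le_floor hyx').trans (Nat.floor_natCast x).le)
  rw [coupledLcmSumW_eq_integral_freqKernel hF₂ hF₂' hG₂ hG₂' isLcmWeight_phiInv norm_phiInv_le_one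
    (Pw x) m M hy1 hyx' hTF hTG hD, ← integral_coupledPhi_mul_pairModel7 hF₂ hF₂' hG₂ hG₂']
  -- linearity
  have hIK := integrable_coupledPhi_mul_freqKernelW hF₂ hF₂' hG₂ hG₂' isLcmWeight_phiInv (Pw x) m M
    hy1 hyx'
  have hIM : Integrable fun p : ({l : Fin k // l ≠ i} → ℝ × ℝ) × ({l : Fin k // l ≠ i} → ℝ × ℝ) =>
      coupledPhi hF₂ hF₂' hG₂ hG₂' p * (pairModel p.1 * pairModel p.2) := by
    have h := (integrable_fourierPhi_mul_pairModel hF₂ hF₂').mul_prod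
      (integrable_fourierPhi_mul_pairModel hG₂ hG₂')
    refine h.congr (ae_of_all _ fun p => ?_)
    simp only [coupledPhi]; ring
  set L : ℂ := (Real.log x : ℂ) ^ (k - 1) * (Real.log (y ε x) : ℂ) ^ (k - 1) with hLdef
  have hIK' : Integrable fun p : ({l : Fin k // l ≠ i} → ℝ × ℝ) × ({l : Fin k // l ≠ i} → ℝ × ℝ) =>
      L * (coupledPhi hF₂ hF₂' hG₂ hG₂' p * coupledFreqKernelW phiInv (Pw x) m M (x : ℝ) (y ε x) p) :=
    hIK.const_mul L
  have hIM' : Integrable fun p : ({l : Fin k // l ≠ i} → ℝ × ℝ) × ({l : Fin k // l ≠ i} → ℝ × ℝ) =>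
      (S₀ : ℂ) * (coupledPhi hF₂ hF₂' hG₂ hG₂' p * (pairModel p.1 * pairModel p.2)) :=
    hIM.const_mul _
  have hlin : (L * ∫ p, coupledPhi hF₂ hF₂' hG₂ hG₂' p *
        coupledFreqKernelW phiInv (Pw x) m M (x : ℝ) (y ε x) p) -
      (S₀ : ℂ) * (∫ p, coupledPhi hF₂ hF₂' hG₂ hG₂' p * (pairModel p.1 * pairModel p.2)) =
      ∫ p, coupledPhi hF₂ hF₂' hG₂ hG₂' p *
        (L * coupledFreqKernelW phiInv (Pw x) m M (x : ℝ) (y ε x) p -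
          (S₀ : ℂ) * (pairModel p.1 * pairModel p.2)) := by
    have e1 : (∫ p, coupledPhi hF₂ hF₂' hG₂ hG₂' p *
        (L * coupledFreqKernelW phiInv (Pw x) m M (x : ℝ) (y ε x) p -
          (S₀ : ℂ) * (pairModel p.1 * pairModel p.2))) =
        ∫ p, (L * (coupledPhi hF₂ hF₂' hG₂ hG₂' p *
            coupledFreqKernelW phiInv (Pw x) m M (x : ℝ) (y ε x) p) -
          (S₀ : ℂ) * (coupledPhi hF₂ hF₂' hG₂ hG₂' p * (pairModel p.1 * pairModel p.2))) :=
      integral_congr_ae (ae_of_all _ fun p => by ring)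
    rw [e1, integral_sub hIK' hIM', integral_const_mul, integral_const_mul]
  rw [hlin]
  -- integrate the pointwise bound
  obtain ⟨hImaj, hIval⟩ := integral_pairMaj7 hF₂ hF₂' hG₂ hG₂' n (η₁ * S₀)
    ((Cr + S₀) / (1 + Real.sqrt (Real.log x)))
  have hbound := norm_integral_le_of_norm_le hImaj
    (ae_of_all _ fun p => hpt hF₂ hF₂' hG₂ hG₂' m p₀ hm1 hm hxp hp2 p)
  refine hbound.trans ?_
  rw [hIval]
  have hR1 : 0 < 1 + Real.sqrt (Real.log x) := by positivity
  have hb0 : 0 ≤ (Cr + S₀) / (1 + Real.sqrt (Real.log x)) := by positivity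
  have hmono : η₁ * S₀ * ((∫ p₁, PsiMaj hF₂ hF₂' p₁) * ∫ p₂, PsiMaj hG₂ hG₂' p₂) +
      (Cr + S₀) / (1 + Real.sqrt (Real.log x)) *
        ((∫ p₁, PsiMajB hF₂ hF₂' n p₁) * (∫ p₂, PsiMaj hG₂ hG₂' p₂) +
          (∫ p₁, PsiMaj hF₂ hF₂' p₁) * ∫ p₂, PsiMajB hG₂ hG₂' n p₂) ≤
      η₁ * S₀ * (I₁ * I₂) + (Cr + S₀) / (1 + Real.sqrt (Real.log x)) * J := by
    have e1 : (∫ p₁, PsiMaj hF₂ hF₂' p₁) * (∫ p₂, PsiMaj hG₂ hG₂' p₂) ≤ I₁ * I₂ :=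
      mul_le_mul hI₁le hI₂le hI₂0' hI₁0
    have e2 : (∫ p₁, PsiMajB hF₂ hF₂' n p₁) * (∫ p₂, PsiMaj hG₂ hG₂' p₂) +
        (∫ p₁, PsiMaj hF₂ hF₂' p₁) * (∫ p₂, PsiMajB hG₂ hG₂' n p₂) ≤ J :=
      add_le_add (mul_le_mul hIB₁le hI₂le hI₂0' hIB₁0) (mul_le_mul hI₁le hIB₂le hIB₂0' hI₁0)
    exact add_le_add (mul_le_mul_of_nonneg_left e1 (by positivity))
      (mul_le_mul_of_nonneg_left e2 hb0)
  refine hmono.trans ?_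
  have h1 : η₁ * S₀ * (I₁ * I₂) ≤ η / 2 * S₀ := by
    have hI0 : 0 ≤ I₁ * I₂ := mul_nonneg hI₁0 hI₂0
    have h' : η₁ * (I₁ * I₂) ≤ η / 2 := by
      rw [hη₁, div_mul_eq_mul_div, div_le_div_iff₀ (by positivity) (by norm_num : (0:ℝ) < 2)]
      have e : η * (2 * (I₁ * I₂ + 1)) - η * (I₁ * I₂) * 2 = 2 * η := by ring
      linarith
    calc η₁ * S₀ * (I₁ * I₂) = η₁ * (I₁ * I₂) * S₀ := by ring
      _ ≤ η / 2 * S₀ := mul_le_mul_of_nonneg_right h' hS0pos.le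
  have h2 : (Cr + S₀) / (1 + Real.sqrt (Real.log x)) * J ≤ η / 2 * S₀ := by
    have hle : Cr + S₀ ≤ (2 * Cr + 1) * S₀ := by
      have e : (2 * Cr + 1) * S₀ - (Cr + S₀) = Cr * (2 * S₀ - 1) := by ring
      have h0 : 0 ≤ Cr * (2 * S₀ - 1) := mul_nonneg hCr0 (by linarith)
      linarith
    calc (Cr + S₀) / (1 + Real.sqrt (Real.log x)) * J
        ≤ ((2 * Cr + 1) * S₀) / (1 + Real.sqrt (Real.log x)) * J := by gcongr
      _ = (2 * Cr + 1) * J / (1 + Real.sqrt (Real.log x)) * S₀ := by ring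
      _ ≤ η / 2 * S₀ := mul_le_mul_of_nonneg_right hdecx hS0pos.le
  linarith

set_option maxHeartbeats 400000 in
include hF hF' hG hG' in
/-- **One pair of cutoffs on the free slots, uniformly in `m, p₀`** ((6.29)–(6.33) via (6.8)–(6.19)):
for `0 < ε ≤ 1/2`, cutoffs supported in `[0,1]`, and `η > 0`, eventually in `x : ℕ`, for all
`1 ≤ m ≤ x < p₀ ≤ x²`, `‖(log x)^{k−1} (log y)^{k−1} S^φ − 𝔖⁷ c‖ ≤ η 𝔖⁷`, where
`S^φ = coupledLcmSumW phiInv (P_w) m (restrictPairs i i (couplingSet7 p₀ i)) F F' G G' x y x`,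
`c = pairConst7 F F' G G'` and `𝔖⁷ = singSmall (k−1) x · nuProd7 k x m p₀ i`.
[cite: Maynard2016LargeGaps, Lemma 7 (proof, displays (6.29)–(6.33))] -/
theorem eventually_norm_logpow_mul_coupledLcmSumW7_sub_le {ε : ℝ} (hε0 : 0 < ε) (hε : ε ≤ 1 / 2)
    (hTF : ∀ l, sF l ≤ 1 ∧ sF' l ≤ 1) (hTG : ∀ l, sG l ≤ 1 ∧ sG' l ≤ 1) {η : ℝ} (hη : 0 < η) :
    ∀ᶠ x : ℕ in atTop, ∀ m p₀ : ℕ, 1 ≤ m → m ≤ x → x < p₀ → (p₀ : ℝ) ≤ (x : ℝ) ^ 2 →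
      ‖(Real.log x : ℂ) ^ (k - 1) * (Real.log (y ε x) : ℂ) ^ (k - 1) *
            coupledLcmSumW phiInv (Pw x) m (restrictPairs i i (couplingSet7 k x m p₀ i))
              F F' G G' (x : ℝ) (y ε x) x -
          ((singSmall (k - 1) x * nuProd7 k x m p₀ i : ℝ) : ℂ) * pairConst7 F F' G G'‖ ≤
        η * (singSmall (k - 1) x * nuProd7 k x m p₀ i) := by
  filter_upwards [eventually_norm_logpow_mul_coupledLcmSumW7_sub_le_of_psiMaj_le hF hF' hG hG'
    hε0 hε hη] with x hx m p₀ hm1 hm hxp hp2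
  exact hx hF hF' hG hG' hTF hTG (fun _ _ => le_rfl) (fun _ _ => le_rfl) m p₀ hm1 hm hxp hp2

end Pair

/-! ### The named facts `Lemma7PairBound` and `Lemma7MainLower` are proved -/

/-- **`Lemma7PairBound` holds.** [cite: Maynard2016LargeGaps, Lemma 7 (proof, displays (6.29)–(6.33))] -/
theorem lemma7PairBound_holds : Lemma7PairBound := by
  intro k i F F' G G' sF sF' sG sG' hF hF' hG hG' hTF hTG ε hε0 hε η hη
  filter_upwards [eventually_norm_logpow_mul_coupledLcmSumW7_sub_le hF hF' hG hG' hε0 hε hTF hTG hη]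
    with x hx m p₀ hm1 hm _ hxp hp2
  exact hx m p₀ hm1 hm hxp hp2

/-- **`Lemma7MainLower` holds** — the main term `(J₁^{(i)} J₂ − η) 𝔖_small^{(k−1)} N⁷ ≤
(log x)^{k−1} (log y)^{k−1} S_i` of the solvable-tuple sum of Lemma 7, PROVED (display (6.33)).
[cite: Maynard2016LargeGaps, Lemma 7 (display (6.33))] -/
theorem lemma7MainLower_holds : Lemma7MainLower :=
  lemma7MainLower_of_pairBound lemma7PairBound_holds

end Maynard2016

end Literature.NumberTheory.Sieve

end
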